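import Literature.AlgebraicGeometry.Resolution.MuPTorsorLocalUniformizationRelative
import Literature.AlgebraicGeometry.Resolution.DiscreteSeparableResidueLocalUniformization
import Literature.AlgebraicGeometry.Resolution.ZariskiPatchingProperModelsWeakLU
import Summits.ResolutionOfSingularities.ResolutionOfSingularities.Theorems.SoloInformedRankOne
import HarnessLib

/-!
# The summit split at discrete valuations with separable-algebraic residue field

Summit-side packaging (solo/informed residency, session 3). Write, for a prime `p` and a field
`k` of characteristic `p`,

* `Disc(k, O)` := `O` is a discrete valuation ring (of rank one) and every residue of `O` is a
  root of a separable polynomial over `k` (`HasSeparableResidue`, elementwise: the residue field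
  is separable-algebraic over `k`, of any degree);
* `HD(p)` := the core model-form `μ_p`-torsor steps (`RelMuPTorsorCoreStepsAt`) hold at every
  rank-one valuation ring `O ⊇ k` of every finitely generated `K/k` with `Disc(k, O)`.

`HD(p)` is **Theorem D** of the residency's notes (`paper/theorem-D.md`): a CLAIMED result with a
prose proof (t-adic truncation along the arc after a finite Galois constant extension; descent
because the last step is a normalisation). It is NOT formalised here — every statement below
carries it as the explicit hypothesis `HD`, spelled out. Granted `HD(p)`, Temkin 2013 (height
one) and Cossart–Piltant 2019 (dimension `≤ 3`):

* `relLocalUniformization_of_disc` — **Corollary E**: relative local uniformization at every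
  rank-one `O` with `Disc(k, O)`, in every dimension;
* `resolutionInChar_iff_twoModelPatching_and_discResidual` — resolution in characteristic `p`
  is EQUIVALENT to two-model patching of proper models ∧ the core steps at the rank-one
  valuation rings with `¬ Disc(k, O)` (the residual local core);
* `resolutionOfSingularities_iff_twoModelPatching_and_discResidual` — the same for the summit
  statement (all primes).
The `⇒` directions are unconditional in `HD`.
-/

noncomputable section

namespace Summit.ResolutionOfSingularities.ResolutionOfSingularities.Theorems

open CategoryTheory AlgebraicGeometry
open Literature.AlgebraicGeometry Literature.AlgebraicGeometry.Resolution Polynomial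

/-- Case split: core steps at `Disc` valuation rings (`HD`) and at the others (`H`) give the core
steps at every rank-one valuation ring. -/
theorem rankOneRelCoreSteps_of_disc_and_residual {p : ℕ}
    (HD : ∀ (k K : Type) [Field k] [CharP k p] [Field K] [Algebra k K],
      (⊤ : IntermediateField k K).FG → ∀ O : ValuationSubring K, Nonempty O.valuation.RankOne →
        (∀ c : k, algebraMap k K c ∈ O) → IsDiscreteValuationRing O →
        (∀ t : K, t ∈ O → HasSeparableResidue k O t) → RelMuPTorsorCoreStepsAt p k O)
    (H : ∀ (k K : Type) [Field k] [CharP k p] [Field K] [Algebra k K],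
      (⊤ : IntermediateField k K).FG → ∀ O : ValuationSubring K, Nonempty O.valuation.RankOne →
        (∀ c : k, algebraMap k K c ∈ O) →
        ¬ (IsDiscreteValuationRing O ∧ ∀ t : K, t ∈ O → HasSeparableResidue k O t) →
        RelMuPTorsorCoreStepsAt p k O) :
    ∀ (k K : Type) [Field k] [CharP k p] [Field K] [Algebra k K],
      (⊤ : IntermediateField k K).FG → ∀ O : ValuationSubring K, Nonempty O.valuation.RankOne →
        (∀ c : k, algebraMap k K c ∈ O) → RelMuPTorsorCoreStepsAt p k O := by
  intro k K _ _ _ _ hfg O hr hk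
  by_cases hD : IsDiscreteValuationRing O ∧ ∀ t : K, t ∈ O → HasSeparableResidue k O t
  · exact HD k K hfg O hr hk hD.1 hD.2
  · exact H k K hfg O hr hk hD

/-- **Corollary E (granted Theorem D as `HD`).** Temkin (height one) + Cossart–Piltant (dim ≤ 3)
+ the core steps at `Disc` valuation rings ⇒ relative local uniformization at every rank-one
valuation ring which is discrete with separable-algebraic residue field, in every dimension. -/
theorem relLocalUniformization_of_disc {p : ℕ} [Fact p.Prime]
    (hT₁ : Temkin2013HeightLeOne.{0}) (hCP : CossartPiltant2019LU3.{0})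
    (HD : ∀ (k K : Type) [Field k] [CharP k p] [Field K] [Algebra k K],
      (⊤ : IntermediateField k K).FG → ∀ O : ValuationSubring K, Nonempty O.valuation.RankOne →
        (∀ c : k, algebraMap k K c ∈ O) → IsDiscreteValuationRing O →
        (∀ t : K, t ∈ O → HasSeparableResidue k O t) → RelMuPTorsorCoreStepsAt p k O)
    (k K : Type) [Field k] [CharP k p] [Field K] [Algebra k K]
    (hfg : (⊤ : IntermediateField k K).FG) (O : ValuationSubring K)
    (hr : Nonempty O.valuation.RankOne) (hk : ∀ c : k, algebraMap k K c ∈ O)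
    (hO : IsDiscreteValuationRing O) (hsep : ∀ t : K, t ∈ O → HasSeparableResidue k O t) :
    RelLocalUniformization k K O :=
  relLocalUniformization_of_relCoreStepsAt_of_rankOne hT₁ hCP O hr hk (HD k K hfg O hr hk hO hsep)

/-- Granted `HD`: the residual core (core steps at rank-one `O` with `¬ Disc(k, O)`) gives
relative local uniformization at EVERY valuation ring over `k` (any rank; Novacoski–Spivakovsky
inside `relLocalUniformization_of_rankOne_relCoreSteps`). -/
theorem relLocalUniformization_of_disc_and_residual {p : ℕ} [Fact p.Prime]
    (hT₁ : Temkin2013HeightLeOne.{0}) (hCP : CossartPiltant2019LU3.{0})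
    (HD : ∀ (k K : Type) [Field k] [CharP k p] [Field K] [Algebra k K],
      (⊤ : IntermediateField k K).FG → ∀ O : ValuationSubring K, Nonempty O.valuation.RankOne →
        (∀ c : k, algebraMap k K c ∈ O) → IsDiscreteValuationRing O →
        (∀ t : K, t ∈ O → HasSeparableResidue k O t) → RelMuPTorsorCoreStepsAt p k O)
    (H : ∀ (k K : Type) [Field k] [CharP k p] [Field K] [Algebra k K],
      (⊤ : IntermediateField k K).FG → ∀ O : ValuationSubring K, Nonempty O.valuation.RankOne →
        (∀ c : k, algebraMap k K c ∈ O) →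
        ¬ (IsDiscreteValuationRing O ∧ ∀ t : K, t ∈ O → HasSeparableResidue k O t) →
        RelMuPTorsorCoreStepsAt p k O)
    (k K : Type) [Field k] [CharP k p] [Field K] [Algebra k K] (O : ValuationSubring K) :
    RelLocalUniformization k K O :=
  relLocalUniformization_of_rankOne_relCoreSteps hT₁ hCP
    (fun K _ _ hfg O hr hk => rankOneRelCoreSteps_of_disc_and_residual HD H k K hfg O hr hk) K O

/-- **The split of the summit's `p`-component at `Disc`.** Granted Temkin (height one),
Cossart–Piltant (dim ≤ 3) and Theorem D (`HD`): resolution in characteristic `p` is EQUIVALENT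
to two-model patching of proper models ∧ the core model-form `μ_p`-torsor steps at the rank-one
valuation rings (of finitely generated extensions of fields of characteristic `p`) which are NOT
discrete with separable-algebraic residue field. `⇒` does not use `HD`. -/
theorem resolutionInChar_iff_twoModelPatching_and_discResidual {p : ℕ} [Fact p.Prime]
    (hT₁ : Temkin2013HeightLeOne.{0}) (hCP : CossartPiltant2019LU3.{0})
    (HD : ∀ (k K : Type) [Field k] [CharP k p] [Field K] [Algebra k K],
      (⊤ : IntermediateField k K).FG → ∀ O : ValuationSubring K, Nonempty O.valuation.RankOne →
        (∀ c : k, algebraMap k K c ∈ O) → IsDiscreteValuationRing O →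
        (∀ t : K, t ∈ O → HasSeparableResidue k O t) → RelMuPTorsorCoreStepsAt p k O) :
    ResolutionInChar.{0} p ↔ ProperModel.TwoModelPatching.{0} p ∧
      (∀ (k K : Type) [Field k] [CharP k p] [Field K] [Algebra k K],
        (⊤ : IntermediateField k K).FG → ∀ O : ValuationSubring K,
          Nonempty O.valuation.RankOne → (∀ c : k, algebraMap k K c ∈ O) →
          ¬ (IsDiscreteValuationRing O ∧ ∀ t : K, t ∈ O → HasSeparableResidue k O t) →
            RelMuPTorsorCoreStepsAt p k O) :=
  ⟨fun h => ⟨ProperModel.twoModelPatching_of_resolutionInChar h,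
      fun k K _ _ _ _ _ O _ hk _ => relCoreSteps_of_resolutionInChar h k K O hk⟩,
    fun h => resolutionInChar_of_properTwoModelPatching_of_lu h.1
      (localUniformizationInChar_of_rankOne_relCoreSteps hT₁ hCP
        (rankOneRelCoreSteps_of_disc_and_residual HD h.2))⟩

/-- **The summit itself, split at `Disc`.** Granted Temkin (height one), Cossart–Piltant
(dim ≤ 3) and Theorem D for every prime (`HD`): resolution of singularities in positive
characteristic (verbatim `Literature.AlgebraicGeometry.Resolution.ResolutionOfSingularities`) is
EQUIVALENT to: for every prime `p`, two-model patching of proper models in characteristic `p`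
AND the core model-form `μ_p`-torsor steps at those rank-one valuation rings of finitely
generated extensions of fields of characteristic `p` which are not discrete with
separable-algebraic residue field. -/
theorem resolutionOfSingularities_iff_twoModelPatching_and_discResidual
    (hT₁ : Temkin2013HeightLeOne.{0}) (hCP : CossartPiltant2019LU3.{0})
    (HD : ∀ p : ℕ, p.Prime → ∀ (k K : Type) [Field k] [CharP k p] [Field K] [Algebra k K],
      (⊤ : IntermediateField k K).FG → ∀ O : ValuationSubring K, Nonempty O.valuation.RankOne →
        (∀ c : k, algebraMap k K c ∈ O) → IsDiscreteValuationRing O →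
        (∀ t : K, t ∈ O → HasSeparableResidue k O t) → RelMuPTorsorCoreStepsAt p k O) :
    Literature.AlgebraicGeometry.Resolution.ResolutionOfSingularities ↔
      ∀ p : ℕ, p.Prime → ProperModel.TwoModelPatching.{0} p ∧
      (∀ (k K : Type) [Field k] [CharP k p] [Field K] [Algebra k K],
        (⊤ : IntermediateField k K).FG → ∀ O : ValuationSubring K,
          Nonempty O.valuation.RankOne → (∀ c : k, algebraMap k K c ∈ O) →
          ¬ (IsDiscreteValuationRing O ∧ ∀ t : K, t ∈ O → HasSeparableResidue k O t) →
            RelMuPTorsorCoreStepsAt p k O) := by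
  refine forall_congr' fun p => forall_congr' fun hp => ?_
  haveI : Fact p.Prime := ⟨hp⟩
  exact resolutionInChar_iff_twoModelPatching_and_discResidual hT₁ hCP (HD p hp)

end Summit.ResolutionOfSingularities.ResolutionOfSingularities.Theorems

end
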